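import Summits.CriticalPhenomena.PercolationContinuityZ3.Theorems.PercNearOneGluingNoHeavyQuantCatHullLight
import Summits.CriticalPhenomena.PercolationContinuityZ3.Theorems.PercNearOneGluingNoHeavyQuantGatedCatHullClosure
import HarnessLib

/-!
# QUANT lane R8, T-DEC: THE WIDTH-2 GAPPED PAIR AT ITS NATURAL FLOOR 1/2 IS A TWO-COLUMN MEMBER OF THE GATED CATERPILLAR HULL —
# closed form for every blob size `c` and every root gate `q ∈ [3/4, 1)` (census-2 g76)

builds on p205010 (kernel theorem, internal audit signed; external expert review pending)

Support file (`--supports stmt-CriticalPhenomena-4575`), QUANT lane census seat prim-quant-census-2 (gen 76), rung R8 of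
`run/shared/lean/prim/quant/LADDER.md`.  Definitions of concrete laws only; theorems with standard axioms, no sorries, no `native_decide`.

WHAT.  The lane's light node `TreeBuiltCatHullLight` (✓ p419856; README V430–V433) asks that every tree-built relay-count law at a light floor be a
finite mixture of gated caterpillar laws of the same mean (`LawDec.InGatedCatHull`).  Its sharpest tested family (README V432 (b), lead g47;
census-2 g75 FREEHULL-G75 §4d) is the WIDTH-2 GAPPED PAIR `T = t ∗ t`, `t = R¹[q](R^c[s]) = gate_q(δ₁ ∗ blob(c, s))`, at the NATURAL floor
`x = q·s = 1/2` exactly: exact IN at `x = 1/2` by 3-column floor-tight certificates for `(c, q) ∈ {3,4,5,6} × {.9,.95,.97}`, OUT for `x > 1/2`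
(margins linear in `x − 1/2`).  This file replaces the finitely many `x = 1/2` certificates by ONE CLOSED FORM, valid for EVERY `c : ℕ` and EVERY
real `q ∈ [3/4, 1)`, with TWO columns:
  `T = ½ · [δ_{c+1} ∗ Bern(2q−1)]  +  ½ · gate_u( δ₁ ∗ gate_{v/u}( δ₁ ∗ blob(2c, 1/(2v)) ) )`,   `u = 1 − 2(1−q)²`, `v = q² + (1−q)²`
(column 0: the gated blob forest with blobs `(c+1, 1)`, `(1, 2q−1)`, outer gate `1` — floor-feasible iff `2q − 1 ≥ 1/2`, i.e. `q ≥ 3/4`; column 1: a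
depth-2 caterpillar, floor-TIGHT at its deep blob (`u·(v/u)·(1/(2v)) = 1/2`), outer gate `u`).  Found by hand from g75's remark that the residual
`R = ½·Bin(2, 2q−1) + ½·δ_{2c+2}` of the `½`-column should have a one-parameter 2-column form: in that family the member with weight `0` on the
`R²[q](R^{2c}[1/(2q)])` column is `R` ITSELF as one caterpillar.  Checked in exact arithmetic by two independent certificate checkers (census-2 g76
certpack, code/verify3.py + g75 verify.py) for `c ≤ 8` and nine values of `q` before typing.
* `halfT c q` (the sibling law `t`), `halfPair c q = lconv (c+1) (c+1) t t` (the pair law `T`), value forms `halfT_apply`, `halfPair_apply`;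
* the columns `halfCol0 c q`, `halfCol1 c q` (nested `slice`/`gate` of the tip), `cat_halfCol0`, `cat_halfCol1` (explicit `CatBuilt` derivations at
  floors `1/2` and `(1/2)/u`), their means `halfCol0_mean`, `halfCol1_mean`;
* **`halfPair_eq_mix`** (the certificate identity, pointwise, all `c`, all `q` with `u, v ≠ 0`);
* **`halfPair_inGatedCatHull : 3/4 ≤ q → q < 1 → InGatedCatHull (1/2) (2q + c) (2c + 2) (halfPair c q)`**, `halfPair_mean` (`mean T = 2q + c`),
  **`halfPair_inGatedCatHull_below`** (every floor `0 < x ≤ 1/2`, by `InGatedCatHull.mono`), **`sdec_halfPair`** (`SDEC (1/2) (2c+2) T`, no oracle),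
  `halfPair_gate_inGatedCatHull` (every outer gate: the (G)-type instances); **`treeBuiltCatHullLight_halfPair`** — THE NODE ITSELF ON THE FAMILY:
  for every tree-built presentation `TreeBuilt x M (halfPair c q)` with `x < 1/2`, `InGatedCatHull x (mean) M (halfPair c q)`.
WHY IT MATTERS.  The kernel's tree-built presentations of `T` sit at every floor `x < 1/2` (the sure block `δ_c` has no presentation at floor `1`), so
`halfPair_inGatedCatHull_below` discharges, for this two-parameter family, EXACTLY the instances of `TreeBuiltCatHullLight` (and of the typed
obligation classes `HeavyBelowHalf` / `HeavyGateLight` of ✓ p424685 read at `x = 1/2`).  It is the IN half of README V432 (b) ("the natural-floor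
threshold of the width-2 gapped pair is exactly 1/2") as a theorem for all `c` and all `q ≥ 3/4`; the OUT half (`x > 1/2`) stays numerical.
HONEST STATUS / ADVERSE.  For `1/2 < q < 3/4` column 0 breaks the floor and NO replacement is known: census-2 g76's engine run (g75 colgen, tiers
BB | CAT2 | CAT3, 240 s) finds `(R¹[q](R³[1/(2q)]))²` at floor `1/2` OUT of the gated-blob tier with a B&B certificate (margins 6.3e-3 … 6.6e-2 for
`q ∈ {.74, .7, .65, .6, .55}`) and OUT-PARTIAL of the caterpillar tiers (numerical) — consistent with `x = 1/2` lying ON the boundary there; the node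
itself only asks floors `< 1/2`.  `TreeBuiltCatHullLight`, `CatPairLight`, `SiblingStep`, `FarTreeRow` remain OPEN; RATE class log\* / honest sentence
of `run/shared/lean/prim/quant/README.md` unchanged.  [this work]; census: prim-quant-census-2 g75/g76, prim-quant-lead g47.  Nothing here is cited
as a published result.  The gluing rows served [cite: KozmaNitzan2024, Conjecture 3 (p. 15)]; product measure [cite: Grimmett1999, §1.3 p. 10].
-/

noncomputable section

open scoped BigOperators

namespace Summit.CriticalPhenomena.PercolationContinuityZ3.Theorems
namespace Quant
namespace LawDec

open Finset

/-! ### Point masses: small bookkeeping -/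

/-- a shifted point mass is a point mass: `[n ≤ h]·δ_m(h − n) = δ_{n+m}(h)`. [folklore] -/
theorem halfPt_shift (n m h : ℕ) : (if n ≤ h then pointLaw m (h - n) else 0) = pointLaw (n + m) h := by
  simp only [pointLaw_apply]; split_ifs <;> first | rfl | (exfalso; omega)

/-- under `n ≤ h`: `δ_m(h − n) = δ_{n+m}(h)`. [folklore] -/
theorem halfPt_sub (n m h : ℕ) (hn : n ≤ h) : pointLaw m (h - n) = pointLaw (n + m) h := by rw [← halfPt_shift n m h, if_pos hn]

/-- `lconv` is linear in its left argument (three-term form). [folklore] -/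
theorem lconv_lin3_left (M₁ M₂ : ℕ) (a b d : ℝ) (f g e μ : ℕ → ℝ) (h : ℕ) :
    lconv M₁ M₂ (fun k => a * f k + b * g k + d * e k) μ h =
      a * lconv M₁ M₂ f μ h + b * lconv M₁ M₂ g μ h + d * lconv M₁ M₂ e μ h := by
  simp only [lconv, Finset.mul_sum]
  rw [← Finset.sum_add_distrib, ← Finset.sum_add_distrib]
  refine Finset.sum_congr rfl fun i _ => ?_
  rw [← Finset.sum_add_distrib, ← Finset.sum_add_distrib]
  refine Finset.sum_congr rfl fun k _ => ?_
  split_ifs <;> ring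

/-- a point mass `δ_k`, `k ≤ M₁`, convolved on the left shifts the other law by `k`. [folklore] -/
theorem lconv_pointLaw_left' (M₁ M₂ k : ℕ) (μ : ℕ → ℝ) (hk : k ≤ M₁) (hμM : ∀ h, M₂ < h → μ h = 0) (h : ℕ) :
    lconv M₁ M₂ (pointLaw k) μ h = if k ≤ h then μ (h - k) else 0 := by
  simp only [lconv, pointLaw_apply]
  rw [Finset.sum_eq_single_of_mem k (Finset.mem_range.2 (by omega)) (fun i _ hik => ?_)]
  · simp only [if_true, one_mul]
    by_cases hkh : k ≤ h
    · rw [if_pos hkh]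
      by_cases hm : h - k ≤ M₂
      · rw [Finset.sum_eq_single_of_mem (h - k) (Finset.mem_range.2 (by omega)) (fun t _ ht => ?_)]
        · rw [if_pos (by omega)]
        · rw [if_neg (by omega)]
      · rw [Finset.sum_eq_zero (fun t ht => ?_), hμM (h - k) (by omega)]
        rw [Finset.mem_range] at ht
        rw [if_neg (by omega)]
    · rw [if_neg hkh]
      exact Finset.sum_eq_zero fun t _ => by rw [if_neg (by omega)]
  · exact Finset.sum_eq_zero fun t _ => by rw [if_neg hik, zero_mul, ite_self]

/-! ### The width-2 gapped pair at its natural floor `1/2` -/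

/-- the sub-forest law of the glued sibling `R¹[q](R^c[1/(2q)])` below its root gate: `δ₁ ∗ blob(c, 1/(2q)) = slice δ₁ c (1/(2q))`. [this work] -/
def halfRho (c : ℕ) (q : ℝ) : ℕ → ℝ := slice (pointLaw 1) c (1 / (2 * q))

/-- the glued sibling law `t = R¹[q](R^c[1/(2q)]) = gate_q(δ₁ ∗ blob(c, 1/(2q)))` (natural floor `q·(1/(2q)) = 1/2`, top `c+1`). [this work] -/
def halfT (c : ℕ) (q : ℝ) : ℕ → ℝ := gate (halfRho c q) q

/-- **the width-2 gapped pair** `T = t ∗ t` on `{0..2c+2}` (mean `2q + c`, natural floor `1/2`). [this work] -/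
def halfPair (c : ℕ) (q : ℝ) : ℕ → ℝ := lconv (c + 1) (c + 1) (halfT c q) (halfT c q)

/-- the gate's atom at `0` as a point mass. [folklore] -/
theorem gate_ite_eq_pointLaw (r : ℝ) (h : ℕ) : (if h = 0 then r else 0) = r * pointLaw 0 h := by
  simp only [pointLaw_apply]; split_ifs <;> ring

/-- value form of `t`: `(1−q)·δ₀ + (q − 1/2)·δ₁ + (1/2)·δ_{c+1}`. [this work] -/
theorem halfT_apply (c : ℕ) (q : ℝ) (hq : q ≠ 0) (h : ℕ) :
    halfT c q h = (1 - q) * pointLaw 0 h + (q - 1 / 2) * pointLaw 1 h + (1 / 2) * pointLaw (c + 1) h := by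
  have e : halfRho c q h = (1 - 1 / (2 * q)) * pointLaw 1 h + (1 / (2 * q)) * pointLaw (c + 1) h := by
    simp only [halfRho, slice]
    rw [halfPt_shift c 1 h]
  simp only [halfT, gate]
  rw [e, gate_ite_eq_pointLaw]
  have hq2 : (2 : ℝ) * q ≠ 0 := mul_ne_zero two_ne_zero hq
  field_simp
  ring

/-- `t` vanishes above `c + 1`. [this work] -/
theorem halfT_eq_zero (c : ℕ) (q : ℝ) (hq : q ≠ 0) (h : ℕ) (hh : c + 1 < h) : halfT c q h = 0 := by
  rw [halfT_apply c q hq h]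
  simp [pointLaw_apply, show h ≠ 0 by omega, show h ≠ 1 by omega, show h ≠ c + 1 by omega]

/-- **value form of the pair law**:
`T = (1−q)²·δ₀ + 2(1−q)(q−½)·δ₁ + (q−½)²·δ₂ + (1−q)·δ_{c+1} + (q−½)·δ_{c+2} + ¼·δ_{2c+2}`. [this work] -/
theorem halfPair_apply (c : ℕ) (q : ℝ) (hq : q ≠ 0) (h : ℕ) :
    halfPair c q h = (1 - q) ^ 2 * pointLaw 0 h + 2 * (1 - q) * (q - 1 / 2) * pointLaw 1 h + (q - 1 / 2) ^ 2 * pointLaw 2 h +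
      (1 - q) * pointLaw (c + 1) h + (q - 1 / 2) * pointLaw (c + 2) h + (1 / 4) * pointLaw (2 * c + 2) h := by
  have eT : halfT c q = fun k => (1 - q) * pointLaw 0 k + (q - 1 / 2) * pointLaw 1 k + (1 / 2) * pointLaw (c + 1) k :=
    funext fun k => halfT_apply c q hq k
  have hz : ∀ k, c + 1 < k → halfT c q k = 0 := halfT_eq_zero c q hq
  have step : halfPair c q h = (1 - q) * lconv (c + 1) (c + 1) (pointLaw 0) (halfT c q) h +
      (q - 1 / 2) * lconv (c + 1) (c + 1) (pointLaw 1) (halfT c q) h +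
      (1 / 2) * lconv (c + 1) (c + 1) (pointLaw (c + 1)) (halfT c q) h := by
    unfold halfPair
    conv_lhs => rw [show lconv (c + 1) (c + 1) (halfT c q) (halfT c q) h =
      lconv (c + 1) (c + 1) (fun k => (1 - q) * pointLaw 0 k + (q - 1 / 2) * pointLaw 1 k + (1 / 2) * pointLaw (c + 1) k)
        (halfT c q) h by rw [← eT]]
    exact lconv_lin3_left (c + 1) (c + 1) _ _ _ _ _ _ (halfT c q) h
  rw [step, lconv_pointLaw_left' (c + 1) (c + 1) 0 _ (by omega) hz h, lconv_pointLaw_left' (c + 1) (c + 1) 1 _ (by omega) hz h,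
    lconv_pointLaw_left' (c + 1) (c + 1) (c + 1) _ le_rfl hz h]
  -- substitute the value form of `t` at the shifted arguments and collect the shifted point masses
  have s0 : (if 0 ≤ h then halfT c q (h - 0) else 0) =
      (1 - q) * pointLaw 0 h + (q - 1 / 2) * pointLaw 1 h + (1 / 2) * pointLaw (c + 1) h := by
    rw [if_pos (Nat.zero_le h), Nat.sub_zero, halfT_apply c q hq h]
  have s1 : (if 1 ≤ h then halfT c q (h - 1) else 0) =
      (1 - q) * pointLaw 1 h + (q - 1 / 2) * pointLaw 2 h + (1 / 2) * pointLaw (c + 2) h := by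
    by_cases h1 : 1 ≤ h
    · rw [if_pos h1, halfT_apply c q hq (h - 1), halfPt_sub 1 0 h h1, halfPt_sub 1 1 h h1, halfPt_sub 1 (c + 1) h h1,
        show 1 + (c + 1) = c + 2 by omega]
    · rw [if_neg h1]
      have h0 : h = 0 := by omega
      subst h0
      simp [pointLaw_apply]
  have s2 : (if c + 1 ≤ h then halfT c q (h - (c + 1)) else 0) =
      (1 - q) * pointLaw (c + 1) h + (q - 1 / 2) * pointLaw (c + 2) h + (1 / 2) * pointLaw (2 * c + 2) h := by
    by_cases h1 : c + 1 ≤ h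
    · rw [if_pos h1, halfT_apply c q hq (h - (c + 1)), halfPt_sub (c + 1) 0 h h1, halfPt_sub (c + 1) 1 h h1,
        halfPt_sub (c + 1) (c + 1) h h1, Nat.add_zero, show c + 1 + 1 = c + 2 by omega,
        show c + 1 + (c + 1) = 2 * c + 2 by omega]
    · rw [if_neg h1]
      simp [pointLaw_apply, show h ≠ c + 1 by omega, show h ≠ c + 2 by omega, show h ≠ 2 * c + 2 by omega]
  rw [s0, s1, s2]
  ring

/-- `T` vanishes above `2c + 2`. [this work] -/
theorem halfPair_eq_zero (c : ℕ) (q : ℝ) (h : ℕ) (hh : 2 * c + 2 < h) : halfPair c q h = 0 := lconv_eq_zero (c + 1) (c + 1) _ _ h (by omega)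

/-- **mean of the pair law**: `Σ_{h ≤ 2c+2} h·T(h) = 2q + c`. [this work] -/
theorem halfPair_mean (c : ℕ) (q : ℝ) (hq : q ≠ 0) :
    ∑ h ∈ Finset.range (2 * c + 2 + 1), (h : ℝ) * halfPair c q h = 2 * q + c := by
  have e : ∀ h : ℕ, (h : ℝ) * halfPair c q h = (1 - q) ^ 2 * ((h : ℝ) * pointLaw 0 h) +
      2 * (1 - q) * (q - 1 / 2) * ((h : ℝ) * pointLaw 1 h) + (q - 1 / 2) ^ 2 * ((h : ℝ) * pointLaw 2 h) +
      (1 - q) * ((h : ℝ) * pointLaw (c + 1) h) + (q - 1 / 2) * ((h : ℝ) * pointLaw (c + 2) h) +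
      (1 / 4) * ((h : ℝ) * pointLaw (2 * c + 2) h) := fun h => by rw [halfPair_apply c q hq h]; ring
  simp_rw [e]
  simp only [Finset.sum_add_distrib, ← Finset.mul_sum]
  rw [sum_mul_pointLaw 0 _ (by omega), sum_mul_pointLaw 1 _ (by omega), sum_mul_pointLaw 2 _ (by omega),
    sum_mul_pointLaw (c + 1) _ (by omega), sum_mul_pointLaw (c + 2) _ (by omega), sum_mul_pointLaw (2 * c + 2) _ le_rfl]
  push_cast
  ring

/-! ### The two certificate columns -/

/-- the closed-form outer gate of column 1: `u = 1 − 2(1−q)²`. [this work] -/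
def halfU (q : ℝ) : ℝ := 1 - 2 * (1 - q) ^ 2

/-- the closed-form depth-1 marginal of column 1: `v = q² + (1−q)²` (`= u·g₁`). [this work] -/
def halfV (q : ℝ) : ℝ := q ^ 2 + (1 - q) ^ 2

/-- column 0: the blob forest `δ_{c+1} ∗ Bern(2q−1)` = blobs `(c+1, 1)`, `(1, 2q−1)` sliced off the tip (outer gate `1`). [this work] -/
def halfCol0 (c : ℕ) (q : ℝ) : ℕ → ℝ := slice (slice (pointLaw 0) (c + 1) 1) 1 (2 * q - 1)

/-- column 1 (inner law, outer gate `u`): the depth-2 caterpillar `δ₁ ∗ gate_{v/u}(δ₁ ∗ blob(2c, 1/(2v)))`. [this work] -/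
def halfCol1 (c : ℕ) (q : ℝ) : ℕ → ℝ :=
  slice (gate (slice (slice (pointLaw 0) 1 1) (2 * c) (1 / (2 * halfV q))) (halfV q / halfU q)) 1 1

/-- bounds on `u`, `v` for `3/4 ≤ q < 1`: `7/8 ≤ u < 1`, `1/2 < v < 1`, `v ≤ u`. [this work] -/
theorem halfUV_bounds (q : ℝ) (hq : 3 / 4 ≤ q) (hq1 : q < 1) :
    7 / 8 ≤ halfU q ∧ halfU q < 1 ∧ 1 / 2 < halfV q ∧ halfV q < 1 ∧ halfV q ≤ halfU q := by
  have h1 : 0 < 1 - q := by linarith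
  have h2 : 0 < q - 1 / 2 := by linarith
  have h3 : 0 < q := by linarith
  simp only [halfU, halfV]
  refine ⟨by nlinarith, by nlinarith [mul_pos h1 h1], by nlinarith [mul_pos h2 h2], by nlinarith [mul_pos h3 h1], by nlinarith⟩

/-- the one-relay slice of the tip is `δ₁`; more generally `slice δ₀ a 1 = δ_a`. [folklore] -/
theorem slice_pointLaw_zero_one (a : ℕ) : slice (pointLaw 0) a 1 = pointLaw a := by
  funext k; simp only [slice]; rw [halfPt_shift a 0 k, Nat.add_zero]; ring

/-- value form of column 0: `(2 − 2q)·δ_{c+1} + (2q − 1)·δ_{c+2}`. [this work] -/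
theorem halfCol0_apply (c : ℕ) (q : ℝ) (h : ℕ) :
    halfCol0 c q h = (2 - 2 * q) * pointLaw (c + 1) h + (2 * q - 1) * pointLaw (c + 2) h := by
  rw [halfCol0, slice_pointLaw_zero_one]
  simp only [slice]
  rw [halfPt_shift 1 (c + 1) h, show 1 + (c + 1) = c + 2 by omega]
  ring

/-- value form of column 1: `(1 − g₁)·δ₁ + g₁(1 − g₂)·δ₂ + g₁g₂·δ_{2c+2}` with `g₁ = v/u`, `g₂ = 1/(2v)`. [this work] -/
theorem halfCol1_apply (c : ℕ) (q : ℝ) (h : ℕ) :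
    halfCol1 c q h = (1 - halfV q / halfU q) * pointLaw 1 h + (halfV q / halfU q) * (1 - 1 / (2 * halfV q)) * pointLaw 2 h +
      (halfV q / halfU q) * (1 / (2 * halfV q)) * pointLaw (2 * c + 2) h := by
  -- the inner gated law, by value
  have eG : ∀ k, gate (slice (slice (pointLaw 0) 1 1) (2 * c) (1 / (2 * halfV q))) (halfV q / halfU q) k =
      (1 - halfV q / halfU q) * pointLaw 0 k + (halfV q / halfU q) * (1 - 1 / (2 * halfV q)) * pointLaw 1 k +
        (halfV q / halfU q) * (1 / (2 * halfV q)) * pointLaw (2 * c + 1) k := by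
    intro k
    rw [slice_pointLaw_zero_one]
    simp only [gate, slice]
    rw [halfPt_shift (2 * c) 1 k, gate_ite_eq_pointLaw]
    ring
  rw [halfCol1]
  rw [show slice (gate (slice (slice (pointLaw 0) 1 1) (2 * c) (1 / (2 * halfV q))) (halfV q / halfU q)) 1 1 h =
    (1 - 1) * gate (slice (slice (pointLaw 0) 1 1) (2 * c) (1 / (2 * halfV q))) (halfV q / halfU q) h +
      1 * (if 1 ≤ h then gate (slice (slice (pointLaw 0) 1 1) (2 * c) (1 / (2 * halfV q))) (halfV q / halfU q) (h - 1) else 0)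
    from rfl]
  by_cases h1 : 1 ≤ h
  · rw [if_pos h1, eG (h - 1), halfPt_sub 1 0 h h1, halfPt_sub 1 1 h h1, halfPt_sub 1 (2 * c + 1) h h1,
      show 1 + (2 * c + 1) = 2 * c + 2 by omega]
    ring
  · rw [if_neg h1]
    have h0 : h = 0 := by omega
    subst h0
    simp [pointLaw_apply]

/-- **column 0 is a caterpillar (indeed a blob forest) at floor `(1/2)/1`** for `3/4 ≤ q ≤ 1`. [this work] -/
theorem cat_halfCol0 (c : ℕ) (q : ℝ) (hq : 3 / 4 ≤ q) (hq1 : q ≤ 1) : CatBuilt ((1 / 2 : ℝ) / 1) (c + 2) (halfCol0 c q) := by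
  have h := ((CatBuilt.nil (1 / 2 : ℝ) (by norm_num) (by norm_num)).slice (c + 1) 1 (by norm_num) le_rfl).slice 1 (2 * q - 1)
    (by linarith) (by linarith)
  rw [div_one, show c + 2 = 0 + (c + 1) + 1 by omega]
  exact h

/-- **column 1 is a depth-2 caterpillar at floor `(1/2)/u`**, floor-tight at its deep blob. [this work] -/
theorem cat_halfCol1 (c : ℕ) (q : ℝ) (hq : 3 / 4 ≤ q) (hq1 : q < 1) :
    CatBuilt ((1 / 2 : ℝ) / halfU q) (2 * c + 2) (halfCol1 c q) := by
  obtain ⟨hu0, _, hv0, _, hvu⟩ := halfUV_bounds q hq hq1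
  have hv2 : 0 < 2 * halfV q := by linarith
  have hx0 : 0 < 1 / (2 * halfV q) := by positivity
  have hx1 : 1 / (2 * halfV q) < 1 := by rw [div_lt_one hv2]; linarith
  have hg0 : 0 < halfV q / halfU q := div_pos (by linarith) (by linarith)
  have hg1 : halfV q / halfU q ≤ 1 := by rw [div_le_one (by linarith)]; exact hvu
  have hfl : halfV q / halfU q * (1 / (2 * halfV q)) ≤ 1 :=
    (lt_of_le_of_lt (mul_le_of_le_one_left hx0.le hg1) hx1).le
  have h := ((((CatBuilt.nil (1 / (2 * halfV q)) hx0 hx1).slice 1 1 hx1.le le_rfl).slice (2 * c) (1 / (2 * halfV q)) le_rfl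
    hx1.le).gate (halfV q / halfU q) hg0 hg1).slice 1 1 hfl le_rfl
  have e : halfV q / halfU q * (1 / (2 * halfV q)) = (1 / 2 : ℝ) / halfU q := by field_simp
  rw [e, show 0 + 1 + 2 * c + 1 = 2 * c + 2 by omega] at h
  exact h

/-- column 0 has mean `2q + c` (outer gate `1`). [this work] -/
theorem halfCol0_mean (c : ℕ) (q : ℝ) :
    (1 : ℝ) * ∑ h ∈ Finset.range (c + 2 + 1), (h : ℝ) * halfCol0 c q h = 2 * q + c := by
  have e : ∀ h : ℕ, (h : ℝ) * halfCol0 c q h =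
      (2 - 2 * q) * ((h : ℝ) * pointLaw (c + 1) h) + (2 * q - 1) * ((h : ℝ) * pointLaw (c + 2) h) :=
    fun h => by rw [halfCol0_apply]; ring
  simp_rw [e]
  rw [Finset.sum_add_distrib, ← Finset.mul_sum, ← Finset.mul_sum, sum_mul_pointLaw (c + 1) _ (by omega),
    sum_mul_pointLaw (c + 2) _ le_rfl]
  push_cast
  ring

/-- column 1 has mean `2q + c` after its outer gate `u` (uses `u·g₁ = v`, `v·g₂ = 1/2`). [this work] -/
theorem halfCol1_mean (c : ℕ) (q : ℝ) (hq : 3 / 4 ≤ q) (hq1 : q < 1) :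
    halfU q * ∑ h ∈ Finset.range (2 * c + 2 + 1), (h : ℝ) * halfCol1 c q h = 2 * q + c := by
  obtain ⟨hu0, _, hv0, _, _⟩ := halfUV_bounds q hq hq1
  have hu : halfU q ≠ 0 := by linarith
  have hv : halfV q ≠ 0 := by linarith
  have e : ∀ h : ℕ, (h : ℝ) * halfCol1 c q h = (1 - halfV q / halfU q) * ((h : ℝ) * pointLaw 1 h) +
      (halfV q / halfU q) * (1 - 1 / (2 * halfV q)) * ((h : ℝ) * pointLaw 2 h) +
      (halfV q / halfU q) * (1 / (2 * halfV q)) * ((h : ℝ) * pointLaw (2 * c + 2) h) := fun h => by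
    rw [halfCol1_apply]; ring
  simp_rw [e]
  rw [Finset.sum_add_distrib, Finset.sum_add_distrib, ← Finset.mul_sum, ← Finset.mul_sum, ← Finset.mul_sum,
    sum_mul_pointLaw 1 _ (by omega), sum_mul_pointLaw 2 _ (by omega), sum_mul_pointLaw (2 * c + 2) _ le_rfl]
  simp only [halfU, halfV] at hu hv ⊢
  push_cast
  field_simp
  ring

/-! ### The certificate identity and membership -/

/-- **THE CLOSED-FORM CERTIFICATE IDENTITY** (pointwise): `T = ½·gate(col₀, 1) + ½·gate(col₁, u)` whenever `q, u, v ≠ 0`. [this work] -/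
theorem halfPair_eq_mix (c : ℕ) (q : ℝ) (hq : q ≠ 0) (hu : halfU q ≠ 0) (hv : halfV q ≠ 0) (h : ℕ) :
    halfPair c q h = (1 / 2) * gate (halfCol0 c q) 1 h + (1 - 1 / 2) * gate (halfCol1 c q) (halfU q) h := by
  have k1 : halfU q * (halfV q / halfU q) = halfV q := by field_simp
  have k2 : halfV q * (1 / (2 * halfV q)) = 1 / 2 := by field_simp
  rw [halfPair_apply c q hq h, gate_one]
  simp only [gate, halfCol0_apply, halfCol1_apply]
  rw [gate_ite_eq_pointLaw]
  simp only [halfU, halfV] at k1 k2 ⊢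
  linear_combination
    (-(1 / 2) * (-pointLaw 1 h + (1 - 1 / (2 * (q ^ 2 + (1 - q) ^ 2))) * pointLaw 2 h +
      1 / (2 * (q ^ 2 + (1 - q) ^ 2)) * pointLaw (2 * c + 2) h)) * k1 +
    (-(1 / 2) * (-pointLaw 2 h + pointLaw (2 * c + 2) h)) * k2

/-- **THE WIDTH-2 GAPPED PAIR AT ITS NATURAL FLOOR `1/2` IS IN THE GATED CATERPILLAR HULL** — for EVERY blob size `c` and EVERY root gate
`q ∈ [3/4, 1)`: `InGatedCatHull (1/2) (2q + c) (2c + 2) T`, by the two closed-form columns. [this work] -/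
theorem halfPair_inGatedCatHull (c : ℕ) (q : ℝ) (hq : 3 / 4 ≤ q) (hq1 : q < 1) :
    InGatedCatHull (1 / 2) (2 * q + c) (2 * c + 2) (halfPair c q) := by
  obtain ⟨hu0, hu1, hv0, _, _⟩ := halfUV_bounds q hq hq1
  have hq0 : q ≠ 0 := by linarith
  have hu : halfU q ≠ 0 := by linarith
  have hv : halfV q ≠ 0 := by linarith
  -- column 0: outer gate 1, top c+2 ≤ 2c+2
  have m0 : InGatedCatHull (1 / 2) (2 * q + c) (2 * c + 2) (gate (halfCol0 c q) 1) := by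
    have := inGatedCatHull_gate_catBuilt (1 / 2 : ℝ) 1 ⟨by norm_num, le_rfl⟩ (cat_halfCol0 c q hq hq1.le)
      (M := 2 * c + 2) (by omega)
    rwa [halfCol0_mean] at this
  -- column 1: outer gate u, top 2c+2
  have m1 : InGatedCatHull (1 / 2) (2 * q + c) (2 * c + 2) (gate (halfCol1 c q) (halfU q)) := by
    have := inGatedCatHull_gate_catBuilt (1 / 2 : ℝ) (halfU q) ⟨by linarith, hu1.le⟩ (cat_halfCol1 c q hq hq1)
      (M := 2 * c + 2) le_rfl
    rwa [halfCol1_mean c q hq hq1] at this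
  have hmix := InGatedCatHull.mix m0 m1 (t := 1 / 2) (by norm_num) (by norm_num)
  have e : halfPair c q = fun h => (1 / 2) * gate (halfCol0 c q) 1 h + (1 - 1 / 2) * gate (halfCol1 c q) (halfU q) h :=
    funext fun h => halfPair_eq_mix c q hq0 hu hv h
  rw [e]
  exact hmix

/-- **… hence at EVERY floor `0 < x ≤ 1/2`** (`InGatedCatHull.mono`): these are exactly the instances of `TreeBuiltCatHullLight` for the
family (the kernel's tree-built presentations of `T` have floors `< 1/2`), with the mean written as the law's own first moment. [this work] -/
theorem halfPair_inGatedCatHull_below (c : ℕ) (q : ℝ) (hq : 3 / 4 ≤ q) (hq1 : q < 1) (x : ℝ) (hx0 : 0 < x) (hx : x ≤ 1 / 2) :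
    InGatedCatHull x (∑ h ∈ Finset.range (2 * c + 2 + 1), (h : ℝ) * halfPair c q h) (2 * c + 2) (halfPair c q) := by
  rw [halfPair_mean c q (by linarith)]
  exact (halfPair_inGatedCatHull c q hq hq1).mono hx0 hx

/-- **the pair law is SDEC at its natural floor `1/2`** (top `2c + 2`) — no oracle, no induction hypothesis. [this work] -/
theorem sdec_halfPair (c : ℕ) (q : ℝ) (hq : 3 / 4 ≤ q) (hq1 : q < 1) : SDEC (1 / 2) (2 * c + 2) (halfPair c q) :=
  sdec_of_inGatedCatHull (by norm_num) (halfPair_inGatedCatHull c q hq hq1)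

/-- **every outer gate**: `gate T a ∈ InGatedCatHull (a/2) (a·(2q + c)) (2c + 2)` for `0 < a ≤ 1` — the (G)-type instances (light-making gates
`a < 1`) for the family come for free from hull gating. [this work] -/
theorem halfPair_gate_inGatedCatHull (c : ℕ) (q : ℝ) (hq : 3 / 4 ≤ q) (hq1 : q < 1) (a : ℝ) (ha0 : 0 < a) (ha1 : a ≤ 1) :
    InGatedCatHull (a * (1 / 2)) (a * (2 * q + c)) (2 * c + 2) (gate (halfPair c q) a) :=
  inGatedCatHull_gate (halfPair_inGatedCatHull c q hq hq1) (by norm_num) a ha0 ha1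

/-! ### The light node on this family -/

/-- point masses are nonnegative. [folklore] -/
theorem pointLaw_nonneg' (n h : ℕ) : 0 ≤ pointLaw n h := by rw [pointLaw_apply]; split_ifs <;> norm_num

/-- the pair law charges its top atom: `T(2c+2) ≥ 1/4` for `1/2 ≤ q ≤ 1`. [this work] -/
theorem halfPair_top_pos (c : ℕ) (q : ℝ) (hq : 1 / 2 ≤ q) (hq1 : q ≤ 1) : 1 / 4 ≤ halfPair c q (2 * c + 2) := by
  rw [halfPair_apply c q (by linarith)]
  have e : pointLaw (2 * c + 2) (2 * c + 2) = 1 := by simp [pointLaw_apply]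
  rw [e]
  have h1 : 0 ≤ 1 - q := by linarith
  have h2 : 0 ≤ q - 1 / 2 := by linarith
  nlinarith [pointLaw_nonneg' 0 (2 * c + 2), pointLaw_nonneg' 1 (2 * c + 2), pointLaw_nonneg' 2 (2 * c + 2),
    pointLaw_nonneg' (c + 1) (2 * c + 2), pointLaw_nonneg' (c + 2) (2 * c + 2), mul_nonneg h1 h2, mul_nonneg h1 h1,
    mul_nonneg h2 h2, mul_nonneg (mul_nonneg h1 h2) (pointLaw_nonneg' 1 (2 * c + 2)),
    mul_nonneg (mul_nonneg h1 h1) (pointLaw_nonneg' 0 (2 * c + 2)), mul_nonneg (mul_nonneg h2 h2) (pointLaw_nonneg' 2 (2 * c + 2)),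
    mul_nonneg h1 (pointLaw_nonneg' (c + 1) (2 * c + 2)), mul_nonneg h2 (pointLaw_nonneg' (c + 2) (2 * c + 2))]

/-- **THE LIGHT NODE HOLDS ON THIS FAMILY.**  `TreeBuiltCatHullBelow (1/2)` (✓ p419856's `TreeBuiltCatHullLight`) restricted to the laws
`halfPair c q`, `q ∈ [3/4, 1)`: for EVERY tree-built presentation `TreeBuilt x M (halfPair c q)` at a light floor `x < 1/2`, the law is in the
gated caterpillar hull at floor `x`, its own mean and top `M` (any presentation has `M ≥ 2c + 2`; then `mono` + `mono_top`). [this work] -/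
theorem treeBuiltCatHullLight_halfPair (c : ℕ) (q : ℝ) (hq : 3 / 4 ≤ q) (hq1 : q < 1) (x : ℝ) (M : ℕ)
    (hT : TreeBuilt x M (halfPair c q)) (hx : x < 1 / 2) :
    InGatedCatHull x (∑ h ∈ Finset.range (M + 1), (h : ℝ) * halfPair c q h) M (halfPair c q) := by
  obtain ⟨hx0, _, _, hzero, _, _⟩ := treeBuilt_lawFacts hT
  have hM : 2 * c + 2 ≤ M := by
    by_contra hlt
    have h0 := hzero (2 * c + 2) (by omega)
    have := halfPair_top_pos c q (by linarith) hq1.le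
    linarith
  obtain ⟨a, rfl⟩ := Nat.exists_eq_add_of_le hM
  rw [sum_range_extend (fun h => (h : ℝ) * halfPair c q h) (2 * c + 2) a
      (fun h hh => by rw [halfPair_eq_zero c q h hh, mul_zero]), halfPair_mean c q (by linarith)]
  exact ((halfPair_inGatedCatHull c q hq hq1).mono hx0 hx.le).mono_top hM

end LawDec
end Quant
end Summit.CriticalPhenomena.PercolationContinuityZ3.Theorems
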